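import Literature.MathematicalPhysics.StatisticalMechanics.Crystallization
import Mathlib.Algebra.Module.ZLattice.Summable
import HarnessLib

/-!
# Lattice sums of periodic configurations: inverse powers and Lennard-Jones are summable

Topic: `Literature/MathematicalPhysics/StatisticalMechanics`. The energy per particle
`e(F + G) = (2·#F)⁻¹ ∑_{x ∈ F} ∑_{y ∈ F+G, y ≠ x} V(|x - y|)` of a periodic configuration
(`PeriodicConfiguration.energyPerParticle`, `Crystallization.lean`; Blanc–Lewin 2015, (23)) is
defined through a `tsum`, whose junk value `0` would enter for a non-summable lattice sum. This
file proves the summability that `Crystallization.lean` asserts in prose ("for Lennard-Jones in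
`d = 3` every periodic configuration has an absolutely summable energy (`r⁻⁶` tail)"):

* `PeriodicConfiguration.summable_inv_pow_dist` — for `n > d`, `y ↦ |x - y|⁻ⁿ` is summable over
  the points `y ≠ x` of any periodic configuration of `ℝᵈ` (each point is uniquely `z + g`,
  `z ∈ F`, `g ∈ G`, and `∑_{g ∈ G} ‖g - v‖⁻ⁿ < ∞` for `n > rank G = d`: Mathlib
  `ZLattice.summable_norm_sub_inv_pow`).
* `PeriodicConfiguration.summable_lennardJones_dist` — hence the Lennard-Jones lattice sum
  `∑_{y ≠ x} V_LJ(|x - y|)`, `V_LJ = r⁻¹²/12 - r⁻⁶/6`, is (absolutely) summable in every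
  dimension `d ≤ 5`, in particular in `d = 3`: `energyPerParticle lennardJones` carries no junk
  value (Blanc–Lewin 2015, §2.5: lattice energies as Epstein-zeta-type series, convergent for
  exponents `> d`).

## Sources

* X. Blanc, M. Lewin, *The crystallization conjecture: a review*, EMS Surv. Math. Sci. 2 (2015),
  255–306, arXiv:1504.01153, §2.1 (23), §2.5.
-/

noncomputable section

open scoped BigOperators Topology
open Filter Set Metric

namespace Literature.MathematicalPhysics.StatisticalMechanics

variable {d : ℕ}

namespace PeriodicConfiguration

variable (P : PeriodicConfiguration d)

/-- The lattice of periods of a periodic configuration of `ℝᵈ` has rank `d`. [folklore] -/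
theorem finrank_lattice : Module.finrank ℤ P.lattice = d := by
  rw [ZLattice.rank ℝ P.lattice, finrank_euclideanSpace, Fintype.card_fin]

/-- Every point of `F + G` has a motif representative: `y - z ∈ G` for some `z ∈ F`.
[folklore] -/
theorem exists_sub_mem_lattice {y : EuclideanSpace ℝ (Fin d)} (hy : y ∈ P.points) :
    ∃ z ∈ P.motif, y - z ∈ P.lattice := by
  obtain ⟨z, hz, g, hg, rfl⟩ := hy
  exact ⟨z, hz, by simpa using hg⟩

/-- **Inverse powers are summable over a periodic configuration**: for `n > d` and any `x`,
`y ↦ |x - y|⁻ⁿ` is summable over the points `y ≠ x` of a periodic configuration of `ℝᵈ`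
(Epstein-zeta-type convergence; Blanc–Lewin 2015, §2.5). [folklore] -/
theorem summable_inv_pow_dist {n : ℕ} (hn : d < n) (x : EuclideanSpace ℝ (Fin d)) :
    Summable fun y : {y // y ∈ P.points ∧ y ≠ x} => (dist x y.1)⁻¹ ^ n := by
  classical
  have hrep : ∀ y : {y // y ∈ P.points ∧ y ≠ x}, ∃ z : P.motif, y.1 - z.1 ∈ P.lattice :=
    fun y => by
      obtain ⟨z, hz, h⟩ := P.exists_sub_mem_lattice y.2.1
      exact ⟨⟨z, hz⟩, h⟩
  choose rep hrep using hrep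
  let ι : {y // y ∈ P.points ∧ y ≠ x} → P.motif × P.lattice :=
    fun y => (rep y, ⟨y.1 - (rep y).1, hrep y⟩)
  have hι : Function.Injective ι := by
    intro y y' h
    simp only [ι, Prod.mk.injEq, Subtype.mk.injEq] at h
    obtain ⟨h1, h2⟩ := h
    rw [h1] at h2
    exact Subtype.ext (sub_left_injective h2)
  let F : P.motif × P.lattice → ℝ := fun p => (dist x (p.1.1 + p.2.1))⁻¹ ^ n
  have hF : Summable F := by
    refine (summable_prod_of_nonneg fun p => by positivity).2 ⟨fun z => ?_, .of_finite⟩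
    have h := ZLattice.summable_norm_sub_inv_pow P.lattice n (P.finrank_lattice.symm ▸ hn)
      (x - z.1)
    refine h.congr fun l => ?_
    simp only [F, dist_eq_norm]
    rw [show x - (z.1 + l.1) = -(l.1 - (x - z.1)) by abel, norm_neg]
  refine (hF.comp_injective hι).congr fun y => ?_
  simp [F, ι, Function.comp]

/-- `|x - y|⁻⁶` is summable over a periodic configuration of `ℝᵈ`, `d ≤ 5`. [folklore] -/
theorem summable_inv_pow_six_dist (hd : d < 6) (x : EuclideanSpace ℝ (Fin d)) :
    Summable fun y : {y // y ∈ P.points ∧ y ≠ x} => (dist x y.1)⁻¹ ^ 6 :=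
  P.summable_inv_pow_dist hd x

/-- **The Lennard-Jones lattice sum of a periodic configuration is summable** in dimension
`d ≤ 5`, in particular `d = 3`: `∑_{y ∈ F+G, y ≠ x} V_LJ(|x - y|)` with
`V_LJ(r) = r⁻¹²/12 - r⁻⁶/6` (`lennardJones`) converges absolutely, so
`PeriodicConfiguration.energyPerParticle lennardJones` (Blanc–Lewin 2015, (23)) is a genuine
sum. [folklore] -/
theorem summable_lennardJones_dist (hd : d < 6) (x : EuclideanSpace ℝ (Fin d)) :
    Summable fun y : {y // y ∈ P.points ∧ y ≠ x} => lennardJones (dist x y.1) := by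
  have h6 := P.summable_inv_pow_dist hd x
  have h12 := P.summable_inv_pow_dist (show d < 12 by omega) x
  exact (h12.mul_left (1 / 12)).sub (h6.mul_left (1 / 6))

/-- In particular in `ℝ³`. [folklore] -/
theorem summable_lennardJones_dist_three (P : PeriodicConfiguration 3)
    (x : EuclideanSpace ℝ (Fin 3)) :
    Summable fun y : {y // y ∈ P.points ∧ y ≠ x} => lennardJones (dist x y.1) :=
  P.summable_lennardJones_dist (by norm_num) x

/-- Hence the Lennard-Jones energy per particle of a periodic configuration of `ℝ³` is the
limit of its finite partial sums (`HasSum`), not a junk value. [folklore] -/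
theorem hasSum_lennardJones_dist_three (P : PeriodicConfiguration 3)
    (x : EuclideanSpace ℝ (Fin 3)) :
    HasSum (fun y : {y // y ∈ P.points ∧ y ≠ x} => lennardJones (dist x y.1))
      (∑' y : {y // y ∈ P.points ∧ y ≠ x}, lennardJones (dist x y.1)) :=
  (P.summable_lennardJones_dist_three x).hasSum

end PeriodicConfiguration

end Literature.MathematicalPhysics.StatisticalMechanics

end
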